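import Literature.Computability.MetaComplexity.ResolutionWidth
import Literature.Computability.MetaComplexity.ScopeExpansion
import HarnessLib

/-!
# Boundary expansion forces large resolution width (Ben-Sasson–Wigderson 2001, §5–§6)

For a finite indexed family of clauses `A : ι → Finset (Literal ℕ)` whose scope family
`i ↦ vars(A i)` is an `(r, c)`-boundary expander (`IsBoundaryExpander` of `ScopeExpansion.lean`:
every `|I| ≤ r` has `|∂I| ≥ c|I|` unique-neighbour variables) with `c > 0` and `r ≥ 2`, the
empty clause has NO resolution derivation of width `< c r / 2`
(`not_resDerivable_empty_of_isBoundaryExpander`). This is BSW Theorem 4.15 / 6.5 for CNFs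
(clauses are sensitive functions depending on all their variables), proved by BSW's strategy
(§5): `μ(E) = min {|I| : A_I ⊨ E}` is `≤ 1` on axioms and subadditive under resolution;
positive boundaries make every `|I| ≤ r` satisfiable (`exists_forall_eval_of_card_le`), so
`μ(0) > r`; and a minimal implying set has its whole boundary inside the implied clause
(`boundary_subset_clauseVars_of_minimal`), so a clause of medium measure is wide. We run the
argument as an invariant on `ResDerivable` (every width-`w` derivable clause is implied by at
most `r/2` clauses), which avoids speaking of "some clause of the refutation".

## References

* E. Ben-Sasson, A. Wigderson, *Short proofs are narrow — resolution made simple*, J. ACM 48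
  (2001) 149–169, §5 (Def. 5.1, Lemma 5.2, Lemma 5.4, Lemma 5.7, Thm 5.9), Thm 4.15, Thm 6.5.
-/

namespace Literature.Computability.MetaComplexity

open Finset Literature.Computability.Complexity

variable {ι : Type*} [DecidableEq ι]

/-- Positive boundary expansion gives a boundary variable to every small nonempty index set.
[Ben-Sasson–Wigderson 2001, §5] [folklore] -/
theorem boundary_nonempty_of_isBoundaryExpander {S : ι → Finset ℕ} {r c : ℝ}
    (hS : IsBoundaryExpander S r c) (hc : 0 < c) {I : Finset ι} (hI : I.Nonempty)
    (hIr : (I.card : ℝ) ≤ r) : (boundary S I).Nonempty := by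
  rw [← Finset.card_pos]
  have h := hS I hIr
  have hIpos : (0 : ℝ) < I.card := by exact_mod_cast Finset.card_pos.2 hI
  have : (0 : ℝ) < (boundary S I).card := lt_of_lt_of_le (mul_pos hc hIpos) h
  exact_mod_cast this

/-- **Flipping a boundary variable** (BSW Lemma 5.7 for clauses). If `x` occurs in `A i` and in
no other `A j`, `j ∈ I`, then any assignment satisfying the other clauses of `I` can be changed
at `x` alone so as to satisfy all of `I`; clauses not mentioning `x` keep their value.
[Ben-Sasson–Wigderson 2001, Lemma 5.7] [cite: BenSassonWigderson2001, Lemma 5.7] -/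
theorem exists_flip {A : ι → Finset (Literal ℕ)} {I : Finset ι} {i : ι} {x : ℕ}
    (hxi : x ∈ clauseVars (A i)) (huniq : ∀ j ∈ I, x ∈ clauseVars (A j) → j = i)
    {σ : ℕ → Bool} (hσ : ∀ j ∈ I.erase i, finsetClauseEval σ (A j)) :
    ∃ b : Bool, (∀ j ∈ I, finsetClauseEval (Function.update σ x b) (A j)) ∧
      ∀ C : Finset (Literal ℕ), x ∉ clauseVars C →
        (finsetClauseEval (Function.update σ x b) C ↔ finsetClauseEval σ C) := by
  obtain ⟨l₀, hl₀, hl₀x⟩ := mem_clauseVars_iff.1 hxi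
  refine ⟨l₀.2, fun j hj => ?_, fun C hxC => ?_⟩
  · by_cases hji : j = i
    · subst hji
      exact ⟨l₀, hl₀, by simp [Literal.eval, ← hl₀x]⟩
    · have hxj : x ∉ clauseVars (A j) := fun h => hji (huniq j hj h)
      rw [finsetClauseEval_update_iff (fun l hl hlx => hxj (mem_clauseVars_iff.2 ⟨l, hl, hlx⟩))]
      exact hσ j (Finset.mem_erase.2 ⟨hji, hj⟩)
  · exact finsetClauseEval_update_iff (fun l hl hlx => hxC (mem_clauseVars_iff.2 ⟨l, hl, hlx⟩)) _

/-- Unpacking membership in the boundary of the scope family of `A`. [folklore] -/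
theorem exists_unique_index_of_mem_boundary {A : ι → Finset (Literal ℕ)} {I : Finset ι} {x : ℕ}
    (hx : x ∈ boundary (fun i => clauseVars (A i)) I) :
    ∃ i ∈ I, x ∈ clauseVars (A i) ∧ ∀ j ∈ I, x ∈ clauseVars (A j) → j = i := by
  obtain ⟨i, ⟨hi, hxi⟩, huniq⟩ := existsUnique_of_mem_boundary hx
  exact ⟨i, hi, hxi, fun j hj hxj => huniq j ⟨hj, hxj⟩⟩

/-- **Small sets of an expander are satisfiable** (BSW's "partial matchability", obtained here
from positive boundaries by peeling a boundary variable). Every `I` with `|I| ≤ r` has an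
assignment satisfying all `A i`, `i ∈ I`; hence `μ(0) > r`.
[Ben-Sasson–Wigderson 2001, Thm 6.5 (proof), Def. 6.4] [cite: BenSassonWigderson2001, Thm 6.5] -/
theorem exists_forall_eval_of_card_le {A : ι → Finset (Literal ℕ)} {r c : ℝ}
    (hA : IsBoundaryExpander (fun i => clauseVars (A i)) r c) (hc : 0 < c) (I : Finset ι)
    (hIr : (I.card : ℝ) ≤ r) : ∃ σ : ℕ → Bool, ∀ i ∈ I, finsetClauseEval σ (A i) := by
  induction I using Finset.strongInduction with
  | H I ih =>
    rcases I.eq_empty_or_nonempty with rfl | hne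
    · exact ⟨fun _ => false, by simp⟩
    obtain ⟨x, hx⟩ := boundary_nonempty_of_isBoundaryExpander hA hc hne hIr
    obtain ⟨i, hi, hxi, huniq⟩ := exists_unique_index_of_mem_boundary hx
    obtain ⟨σ, hσ⟩ := ih (I.erase i) (Finset.erase_ssubset hi)
      (le_trans (by exact_mod_cast Finset.card_le_card (Finset.erase_subset _ _)) hIr)
    obtain ⟨b, hb, -⟩ := exists_flip hxi huniq hσ
    exact ⟨_, hb⟩

/-- **Boundary variables of a minimal implying set occur in the implied clause** (the heart of
BSW Thm 5.9): if `A_I ⊨ E` but `A_{I ∖ {i}} ⊭ E` for every `i ∈ I`, then `∂I ⊆ vars(E)`.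
[Ben-Sasson–Wigderson 2001, Thm 5.9 (proof)] [cite: BenSassonWigderson2001, Thm 5.9] -/
theorem boundary_subset_clauseVars_of_minimal {A : ι → Finset (Literal ℕ)} {I : Finset ι}
    {E : Finset (Literal ℕ)} (hIE : SemImplies A I E)
    (hmin : ∀ i ∈ I, ¬ SemImplies A (I.erase i) E) :
    boundary (fun i => clauseVars (A i)) I ⊆ clauseVars E := by
  intro x hx
  obtain ⟨i, hi, hxi, huniq⟩ := exists_unique_index_of_mem_boundary hx
  by_contra hxE
  have h := hmin i hi
  unfold SemImplies at h
  push Not at h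
  obtain ⟨σ, hσ, hσE⟩ := h
  obtain ⟨b, hb, hkeep⟩ := exists_flip hxi huniq hσ
  exact hσE ((hkeep E hxE).1 (hIE _ hb))

/-- **The width invariant** (BSW §5: Lemmas 5.2, 5.4 and Thm 5.9 combined). If the scope family
of `A` is an `(r, c)`-boundary expander with `c > 0`, `r ≥ 2`, then every clause `E` derivable
from the clauses of `A` in width `w < c r / 2` is implied by some `I` with `2|I| ≤ r`. (Axioms:
`I = {i}`. Resolution step: the union of the two sets has size `≤ r` and implies `E`; a
minimum-size implying subset `J` of it has `∂J ⊆ vars(E)`, so `c|J| ≤ |∂J| ≤ |E| ≤ w < c r/2`.)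
[Ben-Sasson–Wigderson 2001, §5] [cite: BenSassonWigderson2001, Thm 5.9] -/
theorem exists_semImplies_of_resDerivable {A : ι → Finset (Literal ℕ)} {r c : ℝ}
    (hA : IsBoundaryExpander (fun i => clauseVars (A i)) r c) (hc : 0 < c) (hr : 2 ≤ r) {w : ℕ}
    (hw : (w : ℝ) < c * r / 2) {E : Finset (Literal ℕ)} (hE : ResDerivable (Set.range A) w E) :
    ∃ I : Finset ι, 2 * (I.card : ℝ) ≤ r ∧ SemImplies A I E := by
  classical
  induction hE with
  | ax hA₀ hAE _ =>
    obtain ⟨i, rfl⟩ := hA₀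
    refine ⟨{i}, by simpa using hr, fun σ hσ => ?_⟩
    obtain ⟨l, hl, e⟩ := hσ i (Finset.mem_singleton_self i)
    exact ⟨l, hAE hl, e⟩
  | @res C D E v b _ _ hvC hvD hsub hEw ihC ihD =>
    obtain ⟨I₁, hI₁, hI₁C⟩ := ihC
    obtain ⟨I₂, hI₂, hI₂D⟩ := ihD
    -- the union implies `E`
    have hU : SemImplies A (I₁ ∪ I₂) E := fun σ hσ =>
      finsetClauseEval_of_res (hI₁C σ fun i hi => hσ i (Finset.mem_union_left _ hi))
        (hI₂D σ fun i hi => hσ i (Finset.mem_union_right _ hi)) hsub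
    have hUr : ((I₁ ∪ I₂).card : ℝ) ≤ r := by
      have h := Finset.card_union_le I₁ I₂
      have h' : ((I₁ ∪ I₂).card : ℝ) ≤ I₁.card + I₂.card := by exact_mod_cast h
      linarith
    -- a minimum-cardinality implying subset of the union
    obtain ⟨J, hJmem, hJmin⟩ := Finset.exists_min_image
      ((I₁ ∪ I₂).powerset.filter fun J => SemImplies A J E) Finset.card
      ⟨I₁ ∪ I₂, Finset.mem_filter.2 ⟨Finset.mem_powerset.2 subset_rfl, hU⟩⟩
    rw [Finset.mem_filter, Finset.mem_powerset] at hJmem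
    obtain ⟨hJU, hJE⟩ := hJmem
    have hmin : ∀ i ∈ J, ¬ SemImplies A (J.erase i) E := by
      intro i hi himp
      have := hJmin (J.erase i) (Finset.mem_filter.2
        ⟨Finset.mem_powerset.2 ((Finset.erase_subset _ _).trans hJU), himp⟩)
      rw [Finset.card_erase_of_mem hi] at this
      have := Finset.card_pos.2 ⟨i, hi⟩
      omega
    -- its boundary lies inside `vars(E)`, so it is small
    have hbd := boundary_subset_clauseVars_of_minimal hJE hmin
    have hJr : (J.card : ℝ) ≤ r := le_trans (by exact_mod_cast Finset.card_le_card hJU) hUr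
    have h1 : c * J.card ≤ (boundary (fun i => clauseVars (A i)) J).card := hA J hJr
    have h2 : ((boundary (fun i => clauseVars (A i)) J).card : ℝ) ≤ w := by
      exact_mod_cast ((Finset.card_le_card hbd).trans (card_clauseVars_le E)).trans hEw
    refine ⟨J, ?_, hJE⟩
    have h3 : c * J.card < c * r / 2 := by linarith
    have h4 : (J.card : ℝ) < r / 2 := by
      rw [mul_div_assoc] at h3
      exact lt_of_mul_lt_mul_left h3 hc.le
    linarith

/-- **Expansion ⇒ width** (BSW Thm 4.15 / Thm 6.5 for CNFs): if the scope family of the clause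
family `A` is an `(r, c)`-boundary expander with `c > 0`, `r ≥ 2`, the empty clause is not
derivable from the clauses of `A` in width `< c r / 2`.
[Ben-Sasson–Wigderson 2001, Thm 6.5] [cite: BenSassonWigderson2001, Thm 6.5] -/
theorem not_resDerivable_empty_of_isBoundaryExpander {A : ι → Finset (Literal ℕ)} {r c : ℝ}
    (hA : IsBoundaryExpander (fun i => clauseVars (A i)) r c) (hc : 0 < c) (hr : 2 ≤ r) {w : ℕ}
    (hw : (w : ℝ) < c * r / 2) : ¬ ResDerivable (Set.range A) w ∅ := by
  intro hD
  obtain ⟨I, hI, hIE⟩ := exists_semImplies_of_resDerivable hA hc hr hw hD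
  obtain ⟨σ, hσ⟩ := exists_forall_eval_of_card_le hA hc I
    (by linarith [(Nat.cast_nonneg I.card : (0 : ℝ) ≤ I.card)])
  obtain ⟨l, hl, -⟩ := hIE σ hσ
  simp at hl

end Literature.Computability.MetaComplexity
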